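/-
Copyright: the b2b-balaban cell (near-miss cell 7), T⁴-continuum fan-out; row NE7b ROUND-2 swarm, seat
t4-ne7b-formalise-leaf-05 gen 2 (row S6g′ binding of `t4/b2b-balaban-t4-ne7b-p1/LEAVES-NE7b.md`, owner's ruling R-OWNER-22-12 (2)).
Released under the licence of the surrounding project.
-/
import Summits.QuantumFields.BalabanUV.T4Continuum.Support.HistoryJoinsTotal
import Summits.QuantumFields.BalabanUV.T4Continuum.Support.HistorySiblingMassLayered

/-!
# History joins, part 5: the per-join factor is CLASS-LINEAR up to the rank-fibre display (row S6g′, binding × (d′))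

Summits-side support leaf of the T⁴-continuum cell (rung (B)+1 on a FINITE torus only; NOT infinite volume, NOT the
mass gap, NOT the Clay statement; NOT a proof of the spine estimate NE7b).  Row NE7b, route «COUNT»; row S6g′: the
per-join factor `jfac` of part 4 (`HistoryJoinsTotal`) against leaf-10 gen 2's symmetrised class cost
(`HistorySiblingMassLayered.class_cost_le` ∕ `HistorySiblingMass.sum_exp_neg_rank_le`).  [folklore] finite sums and real
arithmetic over the lineage's own carrier; nothing is quoted from print, nothing printed is asserted, no `[cite:]`
tag, no `Prop` fact of Bałaban's.

WHAT.  For the top join of `merge X Y e` (`r` parts, host `h`, classes = the fibres of `key` over the non-host parts,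
`csize j` = the size of the class represented by `j`): §1 class bookkeeping — `key_rep` (a class representative is
keyed by itself), `sum_csize` (`Σ_j csize j = r − 1`), `symFac_eq_prod` (`symFac = ∏_j (csize j)!`),
`sum_csize_mul_rank` (`Σ_j csize j · rank (part j) = Σ_{i ≠ h} rank (part i)` for a rank reading the part through its
shape).  §2 **`jfac_le_exp`**: with a DISPLAYED rank `rank : ℕ → Gen ε → ℕ` (leaf-10's: age + class of the part's root)
and the DISPLAYED per-join rank-fibre bound `hfib` («at most `ρ + 1` non-empty classes of rank `ρ`» — true for
bare-birth classes, a display for equal-root composite crowds, leaf-10's HONEST SCOPE (ii)), for every `c > 0`: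
`jfac ≤ exp(2(r−1) + c·Σ_{i≠h} rank (part i) + (Σ_j M t (part j))∕(1−e^{−c})²) · ∏_{i≠h} NZ_i`
(`Z^{k}∕k! ≤ exp(2k + c·k·ρ + Z·e^{−cρ})` per class, `class_cost_le`; the rare classes summed by `sum_exp_neg_rank_le`).
Part 6 (`HistoryJoinsBudget`) telescopes this along `jW`.

HONEST SCOPE.  The rank-fibre bound is displayed per join; nothing else is assumed beyond parts 2–4's displayed zone
data.  NE7b NOT proved.  HONEST DEPENDENCY (cell): continuum YM on T⁴ ⇐ BetaPertH ∧ nine spine estimates (0/9 proved);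
BetaPertH ⇐ (D1) ∧ (D4) ∧ CAP+tail.  This file changes none of it.
-/

open Finset
open Literature.MathematicalPhysics.QuantumFieldTheory.Balaban1983to89
open T4PersistenceDictionary T4PartnerMultiplicity T4BranchingRecordsGas
open Summit.QuantumFields.BalabanUV.T4Continuum.HistorySiblingMass
open Summit.QuantumFields.BalabanUV.T4Continuum.HistoryJoins
open Summit.QuantumFields.BalabanUV.T4Continuum.HistoryJoinsAdm
open Summit.QuantumFields.BalabanUV.T4Continuum.HistoryJoinsCount
open Summit.QuantumFields.BalabanUV.T4Continuum.HistoryJoinsTotal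

namespace Summit.QuantumFields.BalabanUV.T4Continuum.HistoryJoinsClass

noncomputable section

open scoped Classical

variable {ε : Type*} (st : ε → ℕ) (X Y : Gen ε) (e : ε)

/-! ## §1 Class bookkeeping of the top join -/

/-- the size of the class represented by `j` (zero unless `j` is the least index of its class) [folklore] -/
def csize (j : Fin (npart st (Gen.merge X Y e))) : ℕ := (univ.filter fun i => key st X Y e i = some j).card

variable {st X Y e}

/-- the key of a non-host part is `some` representative [folklore] -/
theorem key_ne_none_iff (i : Fin (npart st (Gen.merge X Y e))) : key st X Y e i ≠ none ↔ i ≠ hostIdx st X Y e := by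
  unfold key; split_ifs with h <;> simp [h]

/-- **A CLASS REPRESENTATIVE IS KEYED BY ITSELF**: `key i = some j → key j = some j`. [folklore] -/
theorem key_rep {i j : Fin (npart st (Gen.merge X Y e))} (h : key st X Y e i = some j) : key st X Y e j = some j := by
  have hi : i ≠ hostIdx st X Y e := (key_ne_none_iff i).1 (by rw [h]; simp)
  unfold key at h
  rw [dif_neg hi, Option.some.injEq] at h
  -- `j` is the least member of `i`'s class, hence a member: `j ≠ host`, `part j = part i`
  have hmem := Finset.min'_mem (univ.filter fun j' => j' ≠ hostIdx st X Y e ∧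
    (part st _ j').2 = (part st _ i).2) ⟨i, by simp [hi]⟩
  rw [h] at hmem
  simp only [mem_filter, mem_univ, true_and] at hmem
  unfold key
  rw [dif_neg hmem.1, Option.some.injEq]
  have hS : (univ.filter fun j' => j' ≠ hostIdx st X Y e ∧ (part st _ j').2 = (part st (Gen.merge X Y e) j).2) =
      (univ.filter fun j' => j' ≠ hostIdx st X Y e ∧ (part st _ j').2 = (part st (Gen.merge X Y e) i).2) := by
    simp only [hmem.2]
  simp only [hS, h]

/-- the members of a non-empty class have the representative's part [folklore] -/
theorem part_eq_of_key_eq_some {i j : Fin (npart st (Gen.merge X Y e))} (h : key st X Y e i = some j) :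
    (part st _ i).2 = (part st _ j).2 :=
  part_eq_of_key_eq st X Y e (h.trans (key_rep h).symm)

/-- **THE CLASS SIZES SUM TO THE NUMBER OF NON-HOST PARTS.** [folklore] -/
theorem sum_csize : ∑ j, csize st X Y e j = npart st (Gen.merge X Y e) - 1 := by
  have hfib : ∀ i ∈ (univ : Finset (Fin (npart st (Gen.merge X Y e)))).filter (fun i => i ≠ hostIdx st X Y e),
      (key st X Y e i).isSome := by
    intro i hi
    rw [mem_filter] at hi
    exact Option.ne_none_iff_isSome.1 ((key_ne_none_iff i).2 hi.2)
  -- fibrewise over the representative `Option.get`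
  have h1 : ∑ j, csize st X Y e j =
      ((univ : Finset (Fin (npart st (Gen.merge X Y e)))).filter fun i => i ≠ hostIdx st X Y e).card := by
    rw [card_eq_sum_card_fiberwise (f := fun i => (key st X Y e i).getD (hostIdx st X Y e)) (t := univ)
      (fun _ _ => mem_univ _)]
    refine sum_congr rfl fun j _ => ?_
    unfold csize
    congr 1
    ext i
    simp only [mem_filter, mem_univ, true_and]
    constructor
    · intro h; refine ⟨(key_ne_none_iff i).1 (by rw [h]; simp), by simp [h]⟩
    · rintro ⟨hi, hget⟩
      have hs := Option.ne_none_iff_exists'.1 ((key_ne_none_iff i).2 hi)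
      obtain ⟨j', hj'⟩ := hs
      rw [hj'] at hget ⊢
      simp only [Option.getD_some] at hget
      rw [hget]
  rw [h1, filter_ne', card_erase_of_mem (mem_univ _), card_univ, Fintype.card_fin]

/-- **THE SYMMETRY FACTOR IS THE PRODUCT OF THE CLASS FACTORIALS** (the host's class contributes `1! = 1`).
[folklore] -/
theorem symFac_eq_prod : symFac st X Y e = ∏ j, ((csize st X Y e j).factorial : ℝ) := by
  unfold symFac csize
  rw [Fintype.prod_option]
  have h0 : (univ.filter fun i : Fin (npart st (Gen.merge X Y e)) => key st X Y e i = none) = {hostIdx st X Y e} := by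
    ext i
    simp only [mem_filter, mem_univ, true_and, mem_singleton]
    constructor
    · intro h; by_contra hne; exact (key_ne_none_iff i).2 hne h
    · intro h; subst h; unfold key; simp
  have h1 : Fintype.card {i // key st X Y e i = none} = 1 := by
    rw [Fintype.card_subtype, h0, card_singleton]
  rw [h1, Nat.factorial_one, Nat.cast_one, one_mul]
  refine prod_congr rfl fun j _ => ?_
  rw [Fintype.card_subtype]

/-- **CLASS SIZES TIMES RANKS = RANKS OVER THE NON-HOST PARTS** for a rank reading the part through its sub-structure.
[folklore] -/
theorem sum_csize_mul_rank (f : Gen ε → ℝ) :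
    ∑ j, (csize st X Y e j : ℝ) * f (part st _ j).2 =
      ∑ i ∈ univ.filter (fun i => i ≠ hostIdx st X Y e), f (part st (Gen.merge X Y e) i).2 := by
  have h1 : ∀ j, (csize st X Y e j : ℝ) * f (part st _ j).2 =
      ∑ i ∈ univ.filter (fun i => key st X Y e i = some j), f (part st (Gen.merge X Y e) i).2 := by
    intro j
    unfold csize
    rw [sum_congr rfl fun i hi => by rw [part_eq_of_key_eq_some (mem_filter.1 hi).2], sum_const, nsmul_eq_mul]
  rw [sum_congr rfl fun j _ => h1 j]
  rw [← sum_biUnion]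
  · congr 1
    ext i
    simp only [mem_biUnion, mem_univ, true_and, mem_filter]
    constructor
    · rintro ⟨j, hj⟩; exact (key_ne_none_iff i).1 (by rw [hj]; simp)
    · intro hi
      obtain ⟨j, hj⟩ := Option.ne_none_iff_exists'.1 ((key_ne_none_iff i).2 hi)
      exact ⟨j, hj⟩
  · intro j _ j' _ hjj
    simp only [Function.onFun]
    rw [disjoint_filter]
    intro i _ h h'
    exact hjj (Option.some_injective _ (h.symm.trans h'))

/-! ## §2 The per-join factor against the symmetrised class cost -/

variable {γ β R : Type*} [DecidableEq β] [LinearOrder R] [Fintype γ] {D : ℕ}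
  (zone : ℕ → Gen ε → (Addr D → γ) → Finset β) (ρ : (Addr D → γ) → R) (c₀ : γ)
  (M : ℕ → Gen ε → ℕ) (ext : ℕ → Gen ε → ℝ) (NZ : ℝ → ℕ → ℕ → ℕ) (rank : ℕ → Gen ε → ℕ)

/-- one class: `Z^k ∕ k! ≤ exp(2k + c·k·ρ + [k ≥ 1]·Z·e^{−cρ})` for `Z ≥ 0`, `c ≥ 0` [folklore] -/
theorem pow_div_factorial_le_exp {k : ℕ} {Z c : ℝ} (hZ : 0 ≤ Z) (hc : 0 ≤ c) (r : ℕ) :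
    Z ^ k / (Nat.factorial k : ℝ) ≤
      Real.exp (2 * k + c * k * r + (if 1 ≤ k then Z * Real.exp (-(c * r)) else 0)) := by
  rcases Nat.eq_zero_or_pos k with hk | hk
  · subst hk; simp
  · rw [if_pos (show 1 ≤ k from hk)]
    rcases hZ.eq_or_lt with hz | hz
    · rw [← hz, zero_pow (by omega), zero_div]; exact (Real.exp_pos _).le
    · have hcl := class_cost_le hk hz.le hc (Nat.cast_nonneg r)
      have hfac : (0 : ℝ) < Nat.factorial k := by exact_mod_cast Nat.factorial_pos k
      have : Z ^ k / (Nat.factorial k : ℝ) = Real.exp ((k : ℝ) * Real.log Z - Real.log (Nat.factorial k : ℝ)) := by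
        rw [Real.exp_sub, Real.exp_nat_mul, Real.exp_log hz, Real.exp_log hfac]
      rw [this]
      exact Real.exp_le_exp.2 hcl

/-- **THE PER-JOIN FACTOR IS CLASS-LINEAR UP TO THE RANK-FIBRE DISPLAY**: for `c > 0` and the displayed bound «at most
`ρ + 1` non-empty classes of rank `ρ`» at this join,
`jfac ≤ exp(2(r−1) + c·Σ_{i≠h} rank t (part i) + (Σ_j M t (part j))∕(1−e^{−c})²) · ∏_{i≠h} NZ_i`. [folklore] -/
theorem jfac_le_exp {c : ℝ} (hc : 0 < c)
    (hfib : ∀ ρ : ℕ, ((univ.filter fun j : Fin (npart st (Gen.merge X Y e)) => 1 ≤ csize st X Y e j).filter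
      fun j => rank (st e) (part st _ j).2 = ρ).card ≤ ρ + 1) :
    jfac st M ext NZ X Y e ≤
      Real.exp (2 * ((npart st (Gen.merge X Y e) : ℝ) - 1) +
          c * ∑ i ∈ univ.filter (fun i => i ≠ hostIdx st X Y e), (rank (st e) (part st (Gen.merge X Y e) i).2 : ℝ) +
          (∑ j, (M (st e) (part st (Gen.merge X Y e) j).2 : ℝ)) / (1 - Real.exp (-c)) ^ 2) *
        ∏ i : {i // i ≠ hostIdx st X Y e},
          (NZ (ext (st e) (part st (Gen.merge X Y e) i.1).2) (st e) (part st _ i.1).2.rootStep : ℝ) := by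
  set n := npart st (Gen.merge X Y e)
  set Z : ℝ := ∑ j, (M (st e) (part st (Gen.merge X Y e) j).2 : ℝ) with hZdef
  have hZ0 : 0 ≤ Z := sum_nonneg fun _ _ => Nat.cast_nonneg _
  have hNZ0 : 0 ≤ ∏ i : {i // i ≠ hostIdx st X Y e},
      (NZ (ext (st e) (part st (Gen.merge X Y e) i.1).2) (st e) (part st _ i.1).2.rootStep : ℝ) :=
    prod_nonneg fun _ _ => Nat.cast_nonneg _
  have hn : 1 ≤ n := by
    have := one_le_length_clusterParts st (st e) (Gen.merge X Y e)
    simpa [n, npart, jparts] using this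
  -- rewrite the class part of `jfac` as a product over the classes
  have hclass : Z ^ (n - 1) / symFac st X Y e = ∏ j, Z ^ csize st X Y e j / ((csize st X Y e j).factorial : ℝ) := by
    rw [prod_div_distrib, ← symFac_eq_prod, prod_pow_eq_pow_sum, sum_csize]
  have hjfac : jfac st M ext NZ X Y e = (Z ^ (n - 1) / symFac st X Y e) *
      ∏ i : {i // i ≠ hostIdx st X Y e},
        (NZ (ext (st e) (part st (Gen.merge X Y e) i.1).2) (st e) (part st _ i.1).2.rootStep : ℝ) := by
    unfold jfac; ring
  rw [hjfac, hclass]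
  refine mul_le_mul_of_nonneg_right ?_ hNZ0
  -- class by class
  have h1 : ∏ j, Z ^ csize st X Y e j / ((csize st X Y e j).factorial : ℝ) ≤
      ∏ j, Real.exp (2 * csize st X Y e j + c * csize st X Y e j * rank (st e) (part st _ j).2 +
        (if 1 ≤ csize st X Y e j then Z * Real.exp (-(c * rank (st e) (part st _ j).2)) else 0)) :=
    prod_le_prod (fun j _ => div_nonneg (pow_nonneg hZ0 _) (Nat.cast_nonneg _))
      fun j _ => pow_div_factorial_le_exp hZ0 hc.le _
  refine h1.trans ?_
  rw [← Real.exp_sum, Real.exp_le_exp, sum_add_distrib, sum_add_distrib]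
  -- the three sums
  have hs1 : ∑ j, (2 : ℝ) * csize st X Y e j = 2 * ((n : ℝ) - 1) := by
    rw [← mul_sum, ← Nat.cast_sum, sum_csize, Nat.cast_sub hn, Nat.cast_one]
  have hs2 : ∑ j, c * (csize st X Y e j : ℝ) * rank (st e) (part st _ j).2 =
      c * ∑ i ∈ univ.filter (fun i => i ≠ hostIdx st X Y e), (rank (st e) (part st (Gen.merge X Y e) i).2 : ℝ) := by
    rw [← sum_csize_mul_rank (fun Zs => (rank (st e) Zs : ℝ)), mul_sum]
    exact sum_congr rfl fun j _ => by ring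
  have hs3 : ∑ j, (if 1 ≤ csize st X Y e j then Z * Real.exp (-(c * rank (st e) (part st _ j).2)) else 0) ≤
      Z / (1 - Real.exp (-c)) ^ 2 := by
    rw [← sum_filter, ← mul_sum, div_eq_mul_one_div]
    refine mul_le_mul_of_nonneg_left ?_ hZ0
    exact sum_exp_neg_rank_le _ (fun j => rank (st e) (part st (Gen.merge X Y e) j).2) hc hfib
  rw [hs1, hs2]
  linarith

end

end Summit.QuantumFields.BalabanUV.T4Continuum.HistoryJoinsClass
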